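import Summits.Ventures.HodgeRepro2.T5BergmanSchurGeneral

/-!
# The Schur orthogonality relations of the weighted Bergman model (polarised form)

For the weight-`k` model (`k ≥ 2`) of the holomorphic discrete series of `SU(1,1)` and Rühl's Haar
measure `μ_R = ν/π`, the general Schur relation `∫_G |⟨π_k(g) f, h⟩_k|² dμ_R = ⟨f,f⟩_k ⟨h,h⟩_k/(k-1)`
(`T5BergmanSchurGeneral.schur`) is polarised in both slots:

  `∫_G ⟨π_k(g) f₁, h₁⟩_k conj ⟨π_k(g) f₂, h₂⟩_k dμ_R = ⟨f₁, f₂⟩_k ⟨h₂, h₁⟩_k / (k - 1)`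

for ALL holomorphic `f₁, f₂, h₁, h₂ ∈ A_k` (`schur_relations`; in particular the coefficients of
orthogonal vectors are orthogonal in `L²(G, μ_R)`, `integral_mul_conj_eq_zero`). The device is the
polarisation identity for a sesquilinear form vanishing on the diagonal (`eq_zero_of_polar`): first in
the first slot with `h₁ = h₂` (`schur_left`), then in the second slot (`schur_relations`); the
sesquilinearity of both sides is `matrixCoeff_add_const_mul_left` / `_right` and
`T5BergmanFourier.pairing_self_add_const_mul`, and `f + c g ∈ A_k` is `integrableOn_add_const_mul`.

Blind lane: Mathlib + the HodgeRepro2 prefix only; no sorry; axioms ⊆ {propext, Classical.choice,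
Quot.sound}.
-/

namespace Summit.Ventures.HodgeRepro2.T5BergmanSchurPolarized

open MeasureTheory MeasureTheory.Measure Metric Filter Topology
open T5PoincareDensity T5SU11Unimodular T5SU11Fibration T5HaarCircle T5SU11CoefficientL2
open T5BergmanCoefficient T5BergmanPairing T5BergmanUnitary T5BergmanFourier T5BergmanKernel
  T5BergmanParseval T5BergmanPointwise T5BergmanProjection T5BergmanCoefficientL2 T5BergmanActStable
  T5BergmanMatrixCoeff T5BergmanCoeffOrtho T5BergmanSchurGeneral
open scoped Real

/-! ### Polarisation -/

/-- **Polarisation**: if `conj c · x + c · y = 0` for `c = 1` and `c = i`, then `x = y = 0`. -/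
lemma eq_zero_of_polar {x y : ℂ} (h1 : (starRingEnd ℂ) 1 * x + 1 * y = 0)
    (h2 : (starRingEnd ℂ) Complex.I * x + Complex.I * y = 0) : x = 0 ∧ y = 0 := by
  rw [map_one, one_mul, one_mul] at h1
  rw [Complex.conj_I] at h2
  have e1 := congrArg Complex.re h1
  have e2 := congrArg Complex.im h1
  have e3 := congrArg Complex.re h2
  have e4 := congrArg Complex.im h2
  simp only [Complex.add_re, Complex.add_im, Complex.mul_re, Complex.mul_im, Complex.neg_re,
    Complex.neg_im, Complex.I_re, Complex.I_im, Complex.zero_re, Complex.zero_im] at e1 e2 e3 e4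
  constructor <;> apply Complex.ext <;> simp only [Complex.zero_re, Complex.zero_im] <;> linarith

/-- The expansion of `∫ (A + α B) conj (A' + β B')` for integrable products. -/
lemma integral_add_mul_conj_add {μ : Measure SU11} {A B A' B' : SU11 → ℂ} (α β : ℂ)
    (hAA : Integrable (fun g => A g * (starRingEnd ℂ) (A' g)) μ)
    (hAB : Integrable (fun g => A g * (starRingEnd ℂ) (B' g)) μ)
    (hBA : Integrable (fun g => B g * (starRingEnd ℂ) (A' g)) μ)
    (hBB : Integrable (fun g => B g * (starRingEnd ℂ) (B' g)) μ) :
    ∫ g, (A g + α * B g) * (starRingEnd ℂ) (A' g + β * B' g) ∂μ =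
      ∫ g, A g * (starRingEnd ℂ) (A' g) ∂μ +
        (starRingEnd ℂ) β * ∫ g, A g * (starRingEnd ℂ) (B' g) ∂μ +
        α * ∫ g, B g * (starRingEnd ℂ) (A' g) ∂μ +
        α * (starRingEnd ℂ) β * ∫ g, B g * (starRingEnd ℂ) (B' g) ∂μ := by
  have e : ∀ g, (A g + α * B g) * (starRingEnd ℂ) (A' g + β * B' g) =
      A g * (starRingEnd ℂ) (A' g) + (starRingEnd ℂ) β * (A g * (starRingEnd ℂ) (B' g)) +
        α * (B g * (starRingEnd ℂ) (A' g)) +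
        α * (starRingEnd ℂ) β * (B g * (starRingEnd ℂ) (B' g)) := by
    intro g
    simp only [map_add, map_mul]
    ring
  simp_rw [e]
  rw [integral_add, integral_add, integral_add, integral_const_mul, integral_const_mul,
    integral_const_mul]
  all_goals first
    | exact hAA
    | exact hAB.const_mul _
    | exact hBA.const_mul _
    | exact hBB.const_mul _
    | exact hAA.add (hAB.const_mul _)
    | exact (hAA.add (hAB.const_mul _)).add (hBA.const_mul _)

/-! ### `f + c g ∈ A_k` -/

/-- `f + c g` is holomorphic when `f, g` are. -/
lemma differentiableOn_add_const_mul (c : ℂ) {f g : ℂ → ℂ} (hf : DifferentiableOn ℂ f (ball 0 1))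
    (hg : DifferentiableOn ℂ g (ball 0 1)) :
    DifferentiableOn ℂ (f + fun z => c * g z) (ball 0 1) :=
  hf.add ((differentiableOn_const c).mul hg)

/-- `f + c g ∈ A_k` when `f, g ∈ A_k` are continuous on the disc. -/
lemma integrableOn_add_const_mul (k : ℕ) (c : ℂ) {f g : ℂ → ℂ} (hf : ContinuousOn f (ball 0 1))
    (hg : ContinuousOn g (ball 0 1))
    (hfi : IntegrableOn (fun w => ‖f w‖ ^ 2 * (1 - ‖w‖ ^ 2) ^ (k - 2)) (ball (0 : ℂ) 1))
    (hgi : IntegrableOn (fun w => ‖g w‖ ^ 2 * (1 - ‖w‖ ^ 2) ^ (k - 2)) (ball (0 : ℂ) 1)) :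
    IntegrableOn (fun w => ‖(f + fun z => c * g z) w‖ ^ 2 * (1 - ‖w‖ ^ 2) ^ (k - 2))
      (ball (0 : ℂ) 1) := by
  have hcont : ContinuousOn (fun w => ‖(f + fun z => c * g z) w‖ ^ 2 * (1 - ‖w‖ ^ 2) ^ (k - 2))
      (ball (0 : ℂ) 1) :=
    ((hf.add (continuousOn_const.mul hg)).norm.pow 2).mul
      (by fun_prop : Continuous fun w : ℂ => (1 - ‖w‖ ^ 2) ^ (k - 2)).continuousOn
  have hbig : IntegrableOn (fun w => 2 * (‖f w‖ ^ 2 * (1 - ‖w‖ ^ 2) ^ (k - 2)) +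
      2 * ‖c‖ ^ 2 * (‖g w‖ ^ 2 * (1 - ‖w‖ ^ 2) ^ (k - 2))) (ball (0 : ℂ) 1) :=
    (hfi.const_mul 2).add (hgi.const_mul (2 * ‖c‖ ^ 2))
  refine hbig.mono' (hcont.aestronglyMeasurable measurableSet_ball) ?_
  rw [ae_restrict_iff' measurableSet_ball]
  refine Eventually.of_forall fun w hw => ?_
  have hw0 := weight_nonneg k hw
  rw [Real.norm_eq_abs, abs_of_nonneg (by positivity)]
  simp only [Pi.add_apply]
  have hsq : ‖f w + c * g w‖ ^ 2 ≤ 2 * ‖f w‖ ^ 2 + 2 * ‖c‖ ^ 2 * ‖g w‖ ^ 2 := by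
    calc ‖f w + c * g w‖ ^ 2 ≤ (‖f w‖ + ‖c‖ * ‖g w‖) ^ 2 := by
          gcongr
          rw [← norm_mul]
          exact norm_add_le _ _
      _ ≤ 2 * ‖f w‖ ^ 2 + 2 * ‖c‖ ^ 2 * ‖g w‖ ^ 2 := by
          nlinarith [sq_nonneg (‖f w‖ - ‖c‖ * ‖g w‖)]
  calc ‖f w + c * g w‖ ^ 2 * (1 - ‖w‖ ^ 2) ^ (k - 2)
      ≤ (2 * ‖f w‖ ^ 2 + 2 * ‖c‖ ^ 2 * ‖g w‖ ^ 2) * (1 - ‖w‖ ^ 2) ^ (k - 2) := by gcongr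
    _ = 2 * (‖f w‖ ^ 2 * (1 - ‖w‖ ^ 2) ^ (k - 2)) +
          2 * ‖c‖ ^ 2 * (‖g w‖ ^ 2 * (1 - ‖w‖ ^ 2) ^ (k - 2)) := by ring

/-! ### Sesquilinearity of the coefficients -/

/-- `⟨π_k(g)(f + c f'), h⟩_k = ⟨π_k(g) f, h⟩_k + c ⟨π_k(g) f', h⟩_k`. -/
theorem matrixCoeff_add_const_mul_left (k : ℕ) (hk : 2 ≤ k) (c : ℂ) (f f' h : ℂ → ℂ)
    (hf : DifferentiableOn ℂ f (ball 0 1))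
    (hfint : IntegrableOn (fun w => ‖f w‖ ^ 2 * (1 - ‖w‖ ^ 2) ^ (k - 2)) (ball (0 : ℂ) 1))
    (hf' : DifferentiableOn ℂ f' (ball 0 1))
    (hf'int : IntegrableOn (fun w => ‖f' w‖ ^ 2 * (1 - ‖w‖ ^ 2) ^ (k - 2)) (ball (0 : ℂ) 1))
    (hh : ContinuousOn h (ball 0 1))
    (hhint : IntegrableOn (fun w => ‖h w‖ ^ 2 * (1 - ‖w‖ ^ 2) ^ (k - 2)) (ball (0 : ℂ) 1)) (g : SU11) :
    matrixCoeff k (f + fun z => c * f' z) h g = matrixCoeff k f h g + c * matrixCoeff k f' h g := by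
  have hcf' : IntegrableOn (fun w => ‖c * f' w‖ ^ 2 * (1 - ‖w‖ ^ 2) ^ (k - 2)) (ball (0 : ℂ) 1) := by
    refine IntegrableOn.congr_fun (hf'int.const_mul (‖c‖ ^ 2)) (fun w _ => ?_) measurableSet_ball
    rw [norm_mul, mul_pow]
    ring
  rw [matrixCoeff_add_left k hk f (fun z => c * f' z) h hf hfint
    ((differentiableOn_const c).mul hf') hcf' hh hhint, matrixCoeff_const_mul_left]

/-- `⟨π_k(g) f, h + c h'⟩_k = ⟨π_k(g) f, h⟩_k + conj c ⟨π_k(g) f, h'⟩_k`. -/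
theorem matrixCoeff_add_const_mul_right (k : ℕ) (hk : 2 ≤ k) (c : ℂ) (f h h' : ℂ → ℂ)
    (hf : DifferentiableOn ℂ f (ball 0 1))
    (hfint : IntegrableOn (fun w => ‖f w‖ ^ 2 * (1 - ‖w‖ ^ 2) ^ (k - 2)) (ball (0 : ℂ) 1))
    (hh : ContinuousOn h (ball 0 1))
    (hhint : IntegrableOn (fun w => ‖h w‖ ^ 2 * (1 - ‖w‖ ^ 2) ^ (k - 2)) (ball (0 : ℂ) 1))
    (hh' : ContinuousOn h' (ball 0 1))
    (hh'int : IntegrableOn (fun w => ‖h' w‖ ^ 2 * (1 - ‖w‖ ^ 2) ^ (k - 2)) (ball (0 : ℂ) 1))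
    (g : SU11) :
    matrixCoeff k f (h + fun z => c * h' z) g =
      matrixCoeff k f h g + (starRingEnd ℂ) c * matrixCoeff k f h' g := by
  have hch' : IntegrableOn (fun w => ‖c * h' w‖ ^ 2 * (1 - ‖w‖ ^ 2) ^ (k - 2)) (ball (0 : ℂ) 1) := by
    refine IntegrableOn.congr_fun (hh'int.const_mul (‖c‖ ^ 2)) (fun w _ => ?_) measurableSet_ball
    rw [norm_mul, mul_pow]
    ring
  rw [matrixCoeff_add_right k hk f h (fun z => c * h' z) hf hfint hh hhint
    (continuousOn_const.mul hh') hch', matrixCoeff_const_mul_right]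

variable [MeasurableSpace Circle] [BorelSpace Circle]

/-- The product of two matrix coefficients is `μ_R`-integrable. -/
theorem integrable_matrixCoeff_mul_conj (k : ℕ) (hk : 2 ≤ k) (f₁ h₁ f₂ h₂ : ℂ → ℂ)
    (hf₁ : DifferentiableOn ℂ f₁ (ball 0 1))
    (hf₁int : IntegrableOn (fun w => ‖f₁ w‖ ^ 2 * (1 - ‖w‖ ^ 2) ^ (k - 2)) (ball (0 : ℂ) 1))
    (hh₁ : DifferentiableOn ℂ h₁ (ball 0 1))
    (hh₁int : IntegrableOn (fun w => ‖h₁ w‖ ^ 2 * (1 - ‖w‖ ^ 2) ^ (k - 2)) (ball (0 : ℂ) 1))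
    (hf₂ : DifferentiableOn ℂ f₂ (ball 0 1))
    (hf₂int : IntegrableOn (fun w => ‖f₂ w‖ ^ 2 * (1 - ‖w‖ ^ 2) ^ (k - 2)) (ball (0 : ℂ) 1))
    (hh₂ : DifferentiableOn ℂ h₂ (ball 0 1))
    (hh₂int : IntegrableOn (fun w => ‖h₂ w‖ ^ 2 * (1 - ‖w‖ ^ 2) ^ (k - 2)) (ball (0 : ℂ) 1)) :
    Integrable (fun g => matrixCoeff k f₁ h₁ g * (starRingEnd ℂ) (matrixCoeff k f₂ h₂ g)) ruhl :=
  integrable_mul_conj (continuous_matrixCoeff_of_differentiableOn k hk f₁ hf₁ hf₁int h₁ hh₁ hh₁int)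
    (continuous_matrixCoeff_of_differentiableOn k hk f₂ hf₂ hf₂int h₂ hh₂ hh₂int)
    (integral_norm_matrixCoeff_sq_ruhl k hk _ f₁ hf₁ (hasSum_taylor f₁ hf₁) hf₁int _ h₁
      (hasSum_taylor h₁ hh₁) hh₁int).1
    (integral_norm_matrixCoeff_sq_ruhl k hk _ f₂ hf₂ (hasSum_taylor f₂ hf₂) hf₂int _ h₂
      (hasSum_taylor h₂ hh₂) hh₂int).1

/-- The diagonal, as a complex number: `∫ c conj c dμ_R = ⟨f,f⟩_k ⟨h,h⟩_k / (k-1)`. -/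
theorem integral_mul_conj_self (k : ℕ) (hk : 2 ≤ k) (f h : ℂ → ℂ)
    (hf : DifferentiableOn ℂ f (ball 0 1))
    (hfint : IntegrableOn (fun w => ‖f w‖ ^ 2 * (1 - ‖w‖ ^ 2) ^ (k - 2)) (ball (0 : ℂ) 1))
    (hh : DifferentiableOn ℂ h (ball 0 1))
    (hhint : IntegrableOn (fun w => ‖h w‖ ^ 2 * (1 - ‖w‖ ^ 2) ^ (k - 2)) (ball (0 : ℂ) 1)) :
    ∫ g, matrixCoeff k f h g * (starRingEnd ℂ) (matrixCoeff k f h g) ∂ruhl =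
      (((pairing k f f).re * (pairing k h h).re / ((k : ℝ) - 1) : ℝ) : ℂ) := by
  have e : ∀ g, matrixCoeff k f h g * (starRingEnd ℂ) (matrixCoeff k f h g) =
      ((‖matrixCoeff k f h g‖ ^ 2 : ℝ) : ℂ) := fun g => by
    rw [Complex.mul_conj, Complex.normSq_eq_norm_sq]
  simp_rw [e]
  rw [integral_complex_ofReal, (integral_norm_matrixCoeff_sq_ruhl k hk _ f hf (hasSum_taylor f hf)
    hfint _ h (hasSum_taylor h hh) hhint).2]

/-! ### Polarisation in the first slot -/

/-- **Schur, polarised in the first slot**: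
`∫_G ⟨π_k(g) f₁, h⟩_k conj ⟨π_k(g) f₂, h⟩_k dμ_R = ⟨f₁, f₂⟩_k · ⟨h,h⟩_k/(k-1)`. -/
theorem schur_left (k : ℕ) (hk : 2 ≤ k) (f₁ f₂ h : ℂ → ℂ)
    (hf₁ : DifferentiableOn ℂ f₁ (ball 0 1))
    (hf₁int : IntegrableOn (fun w => ‖f₁ w‖ ^ 2 * (1 - ‖w‖ ^ 2) ^ (k - 2)) (ball (0 : ℂ) 1))
    (hf₂ : DifferentiableOn ℂ f₂ (ball 0 1))
    (hf₂int : IntegrableOn (fun w => ‖f₂ w‖ ^ 2 * (1 - ‖w‖ ^ 2) ^ (k - 2)) (ball (0 : ℂ) 1))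
    (hh : DifferentiableOn ℂ h (ball 0 1))
    (hhint : IntegrableOn (fun w => ‖h w‖ ^ 2 * (1 - ‖w‖ ^ 2) ^ (k - 2)) (ball (0 : ℂ) 1)) :
    ∫ g, matrixCoeff k f₁ h g * (starRingEnd ℂ) (matrixCoeff k f₂ h g) ∂ruhl =
      pairing k f₁ f₂ * (((pairing k h h).re / ((k : ℝ) - 1) : ℝ) : ℂ) := by
  have hhc : ContinuousOn h (ball 0 1) := hh.continuousOn
  -- the defect of the relation, a sesquilinear form vanishing on the diagonal
  set D : (ℂ → ℂ) → (ℂ → ℂ) → ℂ := fun u v =>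
    (∫ g, matrixCoeff k u h g * (starRingEnd ℂ) (matrixCoeff k v h g) ∂ruhl) -
      pairing k u v * (((pairing k h h).re / ((k : ℝ) - 1) : ℝ) : ℂ) with hD
  have hdiag : ∀ u, DifferentiableOn ℂ u (ball 0 1) →
      IntegrableOn (fun w => ‖u w‖ ^ 2 * (1 - ‖w‖ ^ 2) ^ (k - 2)) (ball (0 : ℂ) 1) → D u u = 0 := by
    intro u hu hui
    simp only [hD]
    rw [integral_mul_conj_self k hk u h hu hui hh hhint, pairing_self_eq_re k u]
    simp only [Complex.ofReal_re]
    push_cast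
    ring
  have hexp : ∀ c : ℂ, D (f₁ + fun z => c * f₂ z) (f₁ + fun z => c * f₂ z) =
      D f₁ f₁ + (starRingEnd ℂ) c * D f₁ f₂ + c * D f₂ f₁ + c * (starRingEnd ℂ) c * D f₂ f₂ := by
    intro c
    simp only [hD]
    simp_rw [matrixCoeff_add_const_mul_left k hk c f₁ f₂ h hf₁ hf₁int hf₂ hf₂int hhc hhint]
    rw [integral_add_mul_conj_add c c
      (integrable_matrixCoeff_mul_conj k hk f₁ h f₁ h hf₁ hf₁int hh hhint hf₁ hf₁int hh hhint)
      (integrable_matrixCoeff_mul_conj k hk f₁ h f₂ h hf₁ hf₁int hh hhint hf₂ hf₂int hh hhint)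
      (integrable_matrixCoeff_mul_conj k hk f₂ h f₁ h hf₂ hf₂int hh hhint hf₁ hf₁int hh hhint)
      (integrable_matrixCoeff_mul_conj k hk f₂ h f₂ h hf₂ hf₂int hh hhint hf₂ hf₂int hh hhint),
      pairing_self_add_const_mul k c hf₁.continuousOn hf₂.continuousOn hf₁int hf₂int,
      ← pairing_conj_symm k f₁ f₂]
    ring
  have hmem : ∀ c : ℂ, D (f₁ + fun z => c * f₂ z) (f₁ + fun z => c * f₂ z) = 0 := fun c =>
    hdiag _ (differentiableOn_add_const_mul c hf₁ hf₂)
      (integrableOn_add_const_mul k c hf₁.continuousOn hf₂.continuousOn hf₁int hf₂int)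
  have h1 := hexp 1
  have hI := hexp Complex.I
  rw [hmem, hdiag f₁ hf₁ hf₁int, hdiag f₂ hf₂ hf₂int] at h1 hI
  have h1' : (starRingEnd ℂ) 1 * D f₁ f₂ + 1 * D f₂ f₁ = 0 := by linear_combination (-1 : ℂ) * h1
  have hI' : (starRingEnd ℂ) Complex.I * D f₁ f₂ + Complex.I * D f₂ f₁ = 0 := by
    linear_combination (-1 : ℂ) * hI
  obtain ⟨hx, -⟩ := eq_zero_of_polar h1' hI'
  simp only [hD] at hx
  exact sub_eq_zero.mp hx

/-! ### Polarisation in the second slot: the orthogonality relations -/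

/-- **The Schur orthogonality relations**:
`∫_G ⟨π_k(g) f₁, h₁⟩_k conj ⟨π_k(g) f₂, h₂⟩_k dμ_R = ⟨f₁, f₂⟩_k ⟨h₂, h₁⟩_k / (k - 1)` for all holomorphic
`f₁, f₂, h₁, h₂ ∈ A_k`, `k ≥ 2`. -/
theorem schur_relations (k : ℕ) (hk : 2 ≤ k) (f₁ f₂ h₁ h₂ : ℂ → ℂ)
    (hf₁ : DifferentiableOn ℂ f₁ (ball 0 1))
    (hf₁int : IntegrableOn (fun w => ‖f₁ w‖ ^ 2 * (1 - ‖w‖ ^ 2) ^ (k - 2)) (ball (0 : ℂ) 1))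
    (hf₂ : DifferentiableOn ℂ f₂ (ball 0 1))
    (hf₂int : IntegrableOn (fun w => ‖f₂ w‖ ^ 2 * (1 - ‖w‖ ^ 2) ^ (k - 2)) (ball (0 : ℂ) 1))
    (hh₁ : DifferentiableOn ℂ h₁ (ball 0 1))
    (hh₁int : IntegrableOn (fun w => ‖h₁ w‖ ^ 2 * (1 - ‖w‖ ^ 2) ^ (k - 2)) (ball (0 : ℂ) 1))
    (hh₂ : DifferentiableOn ℂ h₂ (ball 0 1))
    (hh₂int : IntegrableOn (fun w => ‖h₂ w‖ ^ 2 * (1 - ‖w‖ ^ 2) ^ (k - 2)) (ball (0 : ℂ) 1)) :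
    ∫ g, matrixCoeff k f₁ h₁ g * (starRingEnd ℂ) (matrixCoeff k f₂ h₂ g) ∂ruhl =
      pairing k f₁ f₂ * pairing k h₂ h₁ / ((k : ℂ) - 1) := by
  have hk1 : ((k : ℂ) - 1) ≠ 0 := by
    have : (2 : ℝ) ≤ k := by exact_mod_cast hk
    have h2 : ((k : ℝ) - 1) ≠ 0 := by linarith
    exact_mod_cast h2
  -- the defect in the second slot
  set D : (ℂ → ℂ) → (ℂ → ℂ) → ℂ := fun u v =>
    (∫ g, matrixCoeff k f₁ u g * (starRingEnd ℂ) (matrixCoeff k f₂ v g) ∂ruhl) -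
      pairing k f₁ f₂ * pairing k v u / ((k : ℂ) - 1) with hD
  have hdiag : ∀ u, DifferentiableOn ℂ u (ball 0 1) →
      IntegrableOn (fun w => ‖u w‖ ^ 2 * (1 - ‖w‖ ^ 2) ^ (k - 2)) (ball (0 : ℂ) 1) → D u u = 0 := by
    intro u hu hui
    simp only [hD]
    rw [schur_left k hk f₁ f₂ u hf₁ hf₁int hf₂ hf₂int hu hui, pairing_self_eq_re k u]
    simp only [Complex.ofReal_re]
    push_cast
    ring
  have hexp : ∀ c : ℂ, D (h₁ + fun z => c * h₂ z) (h₁ + fun z => c * h₂ z) =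
      D h₁ h₁ + c * D h₁ h₂ + (starRingEnd ℂ) c * D h₂ h₁ + c * (starRingEnd ℂ) c * D h₂ h₂ := by
    intro c
    simp only [hD]
    simp_rw [matrixCoeff_add_const_mul_right k hk c f₁ h₁ h₂ hf₁ hf₁int hh₁.continuousOn hh₁int
      hh₂.continuousOn hh₂int,
      matrixCoeff_add_const_mul_right k hk c f₂ h₁ h₂ hf₂ hf₂int hh₁.continuousOn hh₁int
      hh₂.continuousOn hh₂int]
    rw [integral_add_mul_conj_add ((starRingEnd ℂ) c) ((starRingEnd ℂ) c)
      (integrable_matrixCoeff_mul_conj k hk f₁ h₁ f₂ h₁ hf₁ hf₁int hh₁ hh₁int hf₂ hf₂int hh₁ hh₁int)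
      (integrable_matrixCoeff_mul_conj k hk f₁ h₁ f₂ h₂ hf₁ hf₁int hh₁ hh₁int hf₂ hf₂int hh₂ hh₂int)
      (integrable_matrixCoeff_mul_conj k hk f₁ h₂ f₂ h₁ hf₁ hf₁int hh₂ hh₂int hf₂ hf₂int hh₁ hh₁int)
      (integrable_matrixCoeff_mul_conj k hk f₁ h₂ f₂ h₂ hf₁ hf₁int hh₂ hh₂int hf₂ hf₂int hh₂ hh₂int),
      pairing_self_add_const_mul k c hh₁.continuousOn hh₂.continuousOn hh₁int hh₂int,
      ← pairing_conj_symm k h₁ h₂, Complex.conj_conj]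
    field_simp
    ring
  have hmem : ∀ c : ℂ, D (h₁ + fun z => c * h₂ z) (h₁ + fun z => c * h₂ z) = 0 := fun c =>
    hdiag _ (differentiableOn_add_const_mul c hh₁ hh₂)
      (integrableOn_add_const_mul k c hh₁.continuousOn hh₂.continuousOn hh₁int hh₂int)
  have h1 := hexp 1
  have hI := hexp Complex.I
  rw [hmem, hdiag h₁ hh₁ hh₁int, hdiag h₂ hh₂ hh₂int] at h1 hI
  have h1' : (starRingEnd ℂ) 1 * D h₂ h₁ + 1 * D h₁ h₂ = 0 := by linear_combination (-1 : ℂ) * h1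
  have hI' : (starRingEnd ℂ) Complex.I * D h₂ h₁ + Complex.I * D h₁ h₂ = 0 := by
    linear_combination (-1 : ℂ) * hI
  obtain ⟨-, hy⟩ := eq_zero_of_polar h1' hI'
  simp only [hD] at hy
  exact sub_eq_zero.mp hy

/-- The orthogonality relations in the `pairing k (act k g f) h` spelling. -/
theorem schur_relations' (k : ℕ) (hk : 2 ≤ k) (f₁ f₂ h₁ h₂ : ℂ → ℂ)
    (hf₁ : DifferentiableOn ℂ f₁ (ball 0 1))
    (hf₁int : IntegrableOn (fun w => ‖f₁ w‖ ^ 2 * (1 - ‖w‖ ^ 2) ^ (k - 2)) (ball (0 : ℂ) 1))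
    (hf₂ : DifferentiableOn ℂ f₂ (ball 0 1))
    (hf₂int : IntegrableOn (fun w => ‖f₂ w‖ ^ 2 * (1 - ‖w‖ ^ 2) ^ (k - 2)) (ball (0 : ℂ) 1))
    (hh₁ : DifferentiableOn ℂ h₁ (ball 0 1))
    (hh₁int : IntegrableOn (fun w => ‖h₁ w‖ ^ 2 * (1 - ‖w‖ ^ 2) ^ (k - 2)) (ball (0 : ℂ) 1))
    (hh₂ : DifferentiableOn ℂ h₂ (ball 0 1))
    (hh₂int : IntegrableOn (fun w => ‖h₂ w‖ ^ 2 * (1 - ‖w‖ ^ 2) ^ (k - 2)) (ball (0 : ℂ) 1)) :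
    ∫ g, pairing k (act k g f₁) h₁ * (starRingEnd ℂ) (pairing k (act k g f₂) h₂) ∂ruhl =
      pairing k f₁ f₂ * pairing k h₂ h₁ / ((k : ℂ) - 1) :=
  schur_relations k hk f₁ f₂ h₁ h₂ hf₁ hf₁int hf₂ hf₂int hh₁ hh₁int hh₂ hh₂int

/-- **Orthogonal vectors have orthogonal coefficients**: if `⟨f₁, f₂⟩_k = 0` or `⟨h₂, h₁⟩_k = 0` then
`∫_G ⟨π_k(g) f₁, h₁⟩_k conj ⟨π_k(g) f₂, h₂⟩_k dμ_R = 0`. -/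
theorem integral_mul_conj_eq_zero (k : ℕ) (hk : 2 ≤ k) (f₁ f₂ h₁ h₂ : ℂ → ℂ)
    (hf₁ : DifferentiableOn ℂ f₁ (ball 0 1))
    (hf₁int : IntegrableOn (fun w => ‖f₁ w‖ ^ 2 * (1 - ‖w‖ ^ 2) ^ (k - 2)) (ball (0 : ℂ) 1))
    (hf₂ : DifferentiableOn ℂ f₂ (ball 0 1))
    (hf₂int : IntegrableOn (fun w => ‖f₂ w‖ ^ 2 * (1 - ‖w‖ ^ 2) ^ (k - 2)) (ball (0 : ℂ) 1))
    (hh₁ : DifferentiableOn ℂ h₁ (ball 0 1))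
    (hh₁int : IntegrableOn (fun w => ‖h₁ w‖ ^ 2 * (1 - ‖w‖ ^ 2) ^ (k - 2)) (ball (0 : ℂ) 1))
    (hh₂ : DifferentiableOn ℂ h₂ (ball 0 1))
    (hh₂int : IntegrableOn (fun w => ‖h₂ w‖ ^ 2 * (1 - ‖w‖ ^ 2) ^ (k - 2)) (ball (0 : ℂ) 1))
    (h0 : pairing k f₁ f₂ = 0 ∨ pairing k h₂ h₁ = 0) :
    ∫ g, matrixCoeff k f₁ h₁ g * (starRingEnd ℂ) (matrixCoeff k f₂ h₂ g) ∂ruhl = 0 := by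
  rw [schur_relations k hk f₁ f₂ h₁ h₂ hf₁ hf₁int hf₂ hf₂int hh₁ hh₁int hh₂ hh₂int]
  rcases h0 with h0 | h0 <;> rw [h0] <;> simp

/-- The relations for `π₃⁺` (`k = 3`, formal degree `2`):
`∫_G ⟨π₃(g) f₁, h₁⟩₃ conj ⟨π₃(g) f₂, h₂⟩₃ dμ_R = ⟨f₁, f₂⟩₃ ⟨h₂, h₁⟩₃ / 2`. -/
theorem schur_relations_three (f₁ f₂ h₁ h₂ : ℂ → ℂ) (hf₁ : DifferentiableOn ℂ f₁ (ball 0 1))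
    (hf₁int : IntegrableOn (fun w => ‖f₁ w‖ ^ 2 * (1 - ‖w‖ ^ 2) ^ (3 - 2)) (ball (0 : ℂ) 1))
    (hf₂ : DifferentiableOn ℂ f₂ (ball 0 1))
    (hf₂int : IntegrableOn (fun w => ‖f₂ w‖ ^ 2 * (1 - ‖w‖ ^ 2) ^ (3 - 2)) (ball (0 : ℂ) 1))
    (hh₁ : DifferentiableOn ℂ h₁ (ball 0 1))
    (hh₁int : IntegrableOn (fun w => ‖h₁ w‖ ^ 2 * (1 - ‖w‖ ^ 2) ^ (3 - 2)) (ball (0 : ℂ) 1))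
    (hh₂ : DifferentiableOn ℂ h₂ (ball 0 1))
    (hh₂int : IntegrableOn (fun w => ‖h₂ w‖ ^ 2 * (1 - ‖w‖ ^ 2) ^ (3 - 2)) (ball (0 : ℂ) 1)) :
    ∫ g, matrixCoeff 3 f₁ h₁ g * (starRingEnd ℂ) (matrixCoeff 3 f₂ h₂ g) ∂ruhl =
      pairing 3 f₁ f₂ * pairing 3 h₂ h₁ / 2 := by
  rw [schur_relations 3 (by norm_num) f₁ f₂ h₁ h₂ hf₁ hf₁int hf₂ hf₂int hh₁ hh₁int hh₂ hh₂int]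
  norm_num

end Summit.Ventures.HodgeRepro2.T5BergmanSchurPolarized
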